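import Mathlib
import HarnessLib
import Literature.Analysis.FluidPDE.NewtonLocalPotential

/-!
# K1 density step, part B: the two limit lemmas (route ScrewLemmaKCoprofile)

Pure measure theory used by the `C² → C¹` density argument for crux K1 `CoprofileIsometry`
(stmt-RiemannHypothesis-21612; desk brief rh-idea-5 SKETCH-21612-K1.md §2):

* `setIntegral_sq_div_le_of_approx` — the truncation/monotone-limit lemma that replaces Fatou: if `a_m → b`
  uniformly on `(0,1)`, `∫₀¹ (c − a_m)² y⁻² ≤ K_m → L`, and `(c − b)² y⁻²` is integrable, then
  `∫₀¹ (c − b)² y⁻² ≤ 2L` (truncate at `ε`, let `m → ∞`, then `ε → 0` by monotone convergence of set integrals);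
* `tendsto_integral_sq_of_tendsto_integral_sub_sq` (`∫(u_k − v)² → 0 ⇒ ∫u_k² → ∫v²`, by the tree's Cauchy–Schwarz
  `Literature.Analysis.FluidPDE.integral_abs_mul_abs_le_sqrt`).

RH-free; nothing here bears on the truth of RH, and RH is not proved by this file or this route.
-/

noncomputable section

set_option linter.dupNamespace false

namespace Summit.RiemannHypothesis.RiemannHypothesis.Theorems.ScrewLemmaKCoprofile

open MeasureTheory Set Filter Topology

/-! ## The truncation / monotone-limit lemma (replaces Fatou) -/

/-- `⋃ₙ (1/(n+2), 1) = (0, 1)`. [folklore] -/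
theorem iUnion_Ioo_inv_nat : (⋃ n : ℕ, Ioo (1 / ((n:ℝ) + 2)) 1) = Ioo (0:ℝ) 1 := by
  ext y
  simp only [mem_iUnion, mem_Ioo]
  constructor
  · rintro ⟨n, h1, h2⟩
    exact ⟨lt_trans (by positivity) h1, h2⟩
  · rintro ⟨h1, h2⟩
    obtain ⟨n, hn⟩ := exists_nat_one_div_lt h1
    refine ⟨n, lt_of_le_of_lt ?_ hn, h2⟩
    gcongr
    linarith

/-- **Truncation lemma.**  Let `c, b, a_m : (0,1) → ℝ` with `|a_m − b| ≤ η_m → 0` uniformly, and suppose the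
weighted energies `∫₀¹ (c − a_m)² y⁻² dy ≤ K_m` with `K_m → L`.  If `(c − b)² y⁻²` is integrable on `(0,1)` then
`∫₀¹ (c − b)² y⁻² dy ≤ 2L`.  (On `(ε,1)`: `(c−b)² ≤ 2(c−a_m)² + 2η_m²`, let `m → ∞`, then `ε → 0` by monotone
convergence of set integrals.) [folklore] -/
theorem setIntegral_sq_div_le_of_approx {a : ℕ → ℝ → ℝ} {b c : ℝ → ℝ} {η K : ℕ → ℝ} {L : ℝ}
    (hη : Tendsto η atTop (𝓝 0))
    (hclose : ∀ m, ∀ y ∈ Ioo (0:ℝ) 1, |a m y - b y| ≤ η m)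
    (hint_m : ∀ m, IntegrableOn (fun y => (c y - a m y) ^ 2 / y ^ 2) (Ioo (0:ℝ) 1))
    (hK : ∀ m, ∫ y in Ioo (0:ℝ) 1, (c y - a m y) ^ 2 / y ^ 2 ≤ K m)
    (hKL : Tendsto K atTop (𝓝 L))
    (hint : IntegrableOn (fun y => (c y - b y) ^ 2 / y ^ 2) (Ioo (0:ℝ) 1)) :
    ∫ y in Ioo (0:ℝ) 1, (c y - b y) ^ 2 / y ^ 2 ≤ 2 * L := by
  -- (i) truncated bound, uniformly in ε ∈ (0,1)
  have htrunc : ∀ ε : ℝ, 0 < ε → ∫ y in Ioo ε 1, (c y - b y) ^ 2 / y ^ 2 ≤ 2 * L := by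
    intro ε hε
    have hsub : Ioo ε 1 ⊆ Ioo (0:ℝ) 1 := Ioo_subset_Ioo hε.le le_rfl
    have hvol : volume.real (Ioo ε 1) ≤ 1 := by
      rw [Real.volume_real_Ioo]
      by_cases h : ε ≤ 1
      · rw [max_eq_left (by linarith)]; linarith
      · rw [max_eq_right (by linarith)]; norm_num
    -- for each m: ∫_{(ε,1)} (c-b)²/y² ≤ 2 K_m + 2 η_m² / ε²
    have hm : ∀ m, ∫ y in Ioo ε 1, (c y - b y) ^ 2 / y ^ 2 ≤ 2 * K m + 2 * (η m) ^ 2 / ε ^ 2 := by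
      intro m
      have h1 : ∫ y in Ioo ε 1, (c y - b y) ^ 2 / y ^ 2
          ≤ ∫ y in Ioo ε 1, (2 * ((c y - a m y) ^ 2 / y ^ 2) + 2 * (η m) ^ 2 / ε ^ 2) := by
        refine setIntegral_mono_on (hint.mono_set hsub)
          (((hint_m m).mono_set hsub).const_mul 2 |>.add (integrableOn_const
            (measure_Ioo_lt_top (a := ε) (b := (1:ℝ))).ne)) measurableSet_Ioo fun y hy => ?_
        have hy0 : 0 < y := hε.trans hy.1
        have hab : |a m y - b y| ≤ η m := hclose m y (hsub hy)
        have hη0 : 0 ≤ η m := (abs_nonneg _).trans hab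
        have hsq1 : (a m y - b y) ^ 2 ≤ (η m) ^ 2 := by
          rw [← sq_abs]; exact pow_le_pow_left₀ (abs_nonneg _) hab 2
        have hy2 : ε ^ 2 ≤ y ^ 2 := pow_le_pow_left₀ hε.le hy.1.le 2
        have hpt : (c y - b y) ^ 2 ≤ 2 * (c y - a m y) ^ 2 + 2 * (a m y - b y) ^ 2 := by
          nlinarith [sq_nonneg ((c y - a m y) - (a m y - b y))]
        calc (c y - b y) ^ 2 / y ^ 2
            ≤ (2 * (c y - a m y) ^ 2 + 2 * (η m) ^ 2) / y ^ 2 := by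
              gcongr; linarith
          _ = 2 * ((c y - a m y) ^ 2 / y ^ 2) + 2 * (η m) ^ 2 / y ^ 2 := by ring
          _ ≤ 2 * ((c y - a m y) ^ 2 / y ^ 2) + 2 * (η m) ^ 2 / ε ^ 2 := by
              gcongr
      have h2 : ∫ y in Ioo ε 1, (2 * ((c y - a m y) ^ 2 / y ^ 2) + 2 * (η m) ^ 2 / ε ^ 2)
          = 2 * (∫ y in Ioo ε 1, (c y - a m y) ^ 2 / y ^ 2)
            + 2 * (η m) ^ 2 / ε ^ 2 * volume.real (Ioo ε 1) := by
        rw [integral_add (((hint_m m).mono_set hsub).const_mul 2) (integrableOn_const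
            (measure_Ioo_lt_top (a := ε) (b := (1:ℝ))).ne), MeasureTheory.integral_const_mul,
          setIntegral_const, smul_eq_mul]
        ring
      have h3 : ∫ y in Ioo ε 1, (c y - a m y) ^ 2 / y ^ 2 ≤ K m :=
        (setIntegral_mono_set (hint_m m) (ae_of_all _ fun y => by positivity)
          (ae_of_all _ hsub)).trans (hK m)
      have hη2 : 0 ≤ 2 * (η m) ^ 2 / ε ^ 2 := by positivity
      calc ∫ y in Ioo ε 1, (c y - b y) ^ 2 / y ^ 2
          ≤ 2 * (∫ y in Ioo ε 1, (c y - a m y) ^ 2 / y ^ 2)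
            + 2 * (η m) ^ 2 / ε ^ 2 * volume.real (Ioo ε 1) := h1.trans_eq h2
        _ ≤ 2 * K m + 2 * (η m) ^ 2 / ε ^ 2 * 1 := by gcongr
        _ = 2 * K m + 2 * (η m) ^ 2 / ε ^ 2 := by ring
    -- m → ∞
    have hlim : Tendsto (fun m => 2 * K m + 2 * (η m) ^ 2 / ε ^ 2) atTop (𝓝 (2 * L + 2 * 0 ^ 2 / ε ^ 2)) :=
      (hKL.const_mul 2).add ((hη.pow 2).const_mul 2 |>.div_const _)
    rw [zero_pow two_ne_zero, mul_zero, zero_div, add_zero] at hlim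
    exact ge_of_tendsto hlim (Eventually.of_forall hm)
  -- (ii) ε → 0 along ε_n = 1/(n+2)
  have hmono : Monotone fun n : ℕ => Ioo (1 / ((n:ℝ) + 2)) (1:ℝ) := by
    intro i j hij
    refine Ioo_subset_Ioo ?_ le_rfl
    gcongr
  have hU := iUnion_Ioo_inv_nat
  have hconv := tendsto_setIntegral_of_monotone (μ := volume)
    (f := fun y : ℝ => (c y - b y) ^ 2 / y ^ 2) (fun n => measurableSet_Ioo) hmono (by rw [hU]; exact hint)
  rw [hU] at hconv
  exact le_of_tendsto' hconv fun n => htrunc _ (by positivity)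

/-! ## Cauchy–Schwarz and continuity of the square integral -/

-- Cauchy–Schwarz `∫ |f||g| ≤ √(∫f²) √(∫g²)` is the tree's `Literature.Analysis.FluidPDE.integral_abs_mul_abs_le_sqrt`.

/-- **Continuity of `u ↦ ∫u²` in `L²`**: if `∫ (u_k − v)² → 0` (all in `L²(μ)`) then `∫ u_k² → ∫ v²`
(`|∫u_k² − ∫v²| ≤ D_k + 2√(∫v²)√D_k`, Cauchy–Schwarz). [folklore] -/
theorem tendsto_integral_sq_of_tendsto_integral_sub_sq {α : Type*} [MeasurableSpace α] {μ : Measure α}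
    {u : ℕ → α → ℝ} {v : α → ℝ} (hu : ∀ k, MemLp (u k) 2 μ) (hv : MemLp v 2 μ)
    (hD : Tendsto (fun k => ∫ x, (u k x - v x) ^ 2 ∂μ) atTop (𝓝 0)) :
    Tendsto (fun k => ∫ x, (u k x) ^ 2 ∂μ) atTop (𝓝 (∫ x, v x ^ 2 ∂μ)) := by
  set V : ℝ := ∫ x, v x ^ 2 ∂μ with hV
  have hVnn : 0 ≤ V := integral_nonneg fun x => sq_nonneg _
  -- the key inequality
  have hkey : ∀ k, |(∫ x, (u k x) ^ 2 ∂μ) - V|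
      ≤ (∫ x, (u k x - v x) ^ 2 ∂μ) + 2 * (Real.sqrt V * Real.sqrt (∫ x, (u k x - v x) ^ 2 ∂μ)) := by
    intro k
    have hd : MemLp (fun x => u k x - v x) 2 μ := (hu k).sub hv
    have hi_u2 : Integrable (fun x => (u k x) ^ 2) μ := (hu k).integrable_sq
    have hi_v2 : Integrable (fun x => v x ^ 2) μ := hv.integrable_sq
    have hi_d2 : Integrable (fun x => (u k x - v x) ^ 2) μ := hd.integrable_sq
    have hi_vd : Integrable (fun x => v x * (u k x - v x)) μ := hv.integrable_mul hd
    have e : (∫ x, (u k x) ^ 2 ∂μ) - V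
        = (∫ x, (u k x - v x) ^ 2 ∂μ) + 2 * ∫ x, v x * (u k x - v x) ∂μ := by
      rw [hV, ← integral_sub hi_u2 hi_v2, ← MeasureTheory.integral_const_mul, ← integral_add hi_d2
        (hi_vd.const_mul 2)]
      refine integral_congr_ae (ae_of_all _ fun x => ?_)
      simp only; ring
    rw [e]
    have hcs : |∫ x, v x * (u k x - v x) ∂μ| ≤ Real.sqrt V * Real.sqrt (∫ x, (u k x - v x) ^ 2 ∂μ) := by
      calc |∫ x, v x * (u k x - v x) ∂μ| ≤ ∫ x, |v x * (u k x - v x)| ∂μ := abs_integral_le_integral_abs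
        _ = ∫ x, |v x| * |u k x - v x| ∂μ := by
            refine integral_congr_ae (ae_of_all _ fun x => ?_); simp only [abs_mul]
        _ ≤ Real.sqrt V * Real.sqrt (∫ x, (u k x - v x) ^ 2 ∂μ) := Literature.Analysis.FluidPDE.integral_abs_mul_abs_le_sqrt hv hd
    have hDnn : 0 ≤ ∫ x, (u k x - v x) ^ 2 ∂μ := integral_nonneg fun x => sq_nonneg _
    calc |(∫ x, (u k x - v x) ^ 2 ∂μ) + 2 * ∫ x, v x * (u k x - v x) ∂μ|
        ≤ |∫ x, (u k x - v x) ^ 2 ∂μ| + |2 * ∫ x, v x * (u k x - v x) ∂μ| := abs_add_le _ _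
      _ = (∫ x, (u k x - v x) ^ 2 ∂μ) + 2 * |∫ x, v x * (u k x - v x) ∂μ| := by
          rw [abs_of_nonneg hDnn, abs_mul, abs_two]
      _ ≤ (∫ x, (u k x - v x) ^ 2 ∂μ) + 2 * (Real.sqrt V * Real.sqrt (∫ x, (u k x - v x) ^ 2 ∂μ)) := by
          gcongr
  have hlim : Tendsto (fun k => (∫ x, (u k x - v x) ^ 2 ∂μ)
      + 2 * (Real.sqrt V * Real.sqrt (∫ x, (u k x - v x) ^ 2 ∂μ))) atTop (𝓝 (0 + 2 * (Real.sqrt V * Real.sqrt 0))) :=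
    hD.add ((hD.sqrt.const_mul _).const_mul _)
  rw [Real.sqrt_zero, mul_zero, mul_zero, add_zero] at hlim
  rw [tendsto_iff_norm_sub_tendsto_zero]
  exact squeeze_zero (fun k => norm_nonneg _) (fun k => by rw [Real.norm_eq_abs]; exact hkey k) hlim

end Summit.RiemannHypothesis.RiemannHypothesis.Theorems.ScrewLemmaKCoprofile

end
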